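import Mathlib.Data.Real.Basic
import Mathlib.Algebra.Order.BigOperators.Group.Finset
import Mathlib.Algebra.BigOperators.Group.Finset.Basic
import Mathlib.Order.Interval.Finset.Nat
import Mathlib.Tactic

/-!
# Literature.Probability.FitznerVanDerHofstad2017.PosExpr — positive expressions: a syntax whose every term is
non-negative and order-preserving

CITATION HEADER (PLACEMENT v2). Part of the certified REPRODUCTION of R. Fitzner, R. van der Hofstad, *Mean-field
behavior for nearest-neighbor percolation in d > 10*, EJP 22 (2017) no. 43 [FvdH17] (notebooks `Percolation.nb`,
`SRW.nb`, `General.nb`) and *Generalized approach to the non-backtracking lace expansion*, PTRF 169 (2017) 1041–1119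
[NoBLE17]; build `lace`, seat lean1 (gen 4), node N28 / GAPS G19 (1) / REFEREE R38.3 ("the stage-1 monotonicity
inputs (cell signs M1–M6) are a sign census, not theorems").

What this module is.  The d = 10 no-go frame (`NoGoFrame.Frame`) takes STAGE 1 of the bound map — `Percolation.nb`
cells 3–43, the several hundred closed-form bounds on two-point functions, repulsive diagrams and lace-expansion
coefficients — as an abstract map `S : State → Stage1` with the hypotheses `Frame.Hyp.mono` / `.nonneg` (fieldwise
order preservation and structural signs).  To make those hypotheses THEOREMS for the concrete cells without one
monotonicity proof per cell, this file introduces a deep-embedded SYNTAX `PX ι κ` of POSITIVE EXPRESSIONS over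
state-dependent atoms `ι` and static table keys `κ` — atoms, table constants, natural literals, `+`, `×`, division by a
natural, `max`, `min`, natural powers, the odd complement `1 − (1 − a)^(2n+1)` and finite range sums — with its real
semantics `PX.eval`, and proves ONCE AND FOR ALL (`PX.eval_nonneg`, `PX.eval_mono`): if every atom and table value is
`≥ 0` then every term evaluates to a non-negative real, and if moreover the atom valuation increases pointwise then the
value of every term increases.  There is deliberately NO subtraction and NO general division: the notebook's divisions
by `(2d z)` are exponent shifts of polynomials in `z` (HOME/MARGINS.md M2), its exact cancellations (M6(a)) are
re-implemented in reduced form, and its two increasing rational forms `1/(1 − G₃)`, `1/(1 − OpenBubble₁)` (M6(c)) become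
derived atoms — all in `Stage1Cells.lean`, which transcribes the cells as `PX` terms; the handful of LOWER bounds with
decreasing brackets (cells 36–37) are typed there by hand.  `PX.evalF` is the same recursion over `Float`, a validation
aid only (the typed cells are re-evaluated numerically against the two certified engines); no theorem mentions it.
Nothing here is a cited fact: definitions and theorems proved from them.

[folklore]
-/

namespace Literature.Probability.FitznerVanDerHofstad2017

/-- POSITIVE EXPRESSIONS over state atoms `ι` and table keys `κ`: the closed sub-language of `Percolation.nb` cells 3–43
in which every operation is monotone and sign-preserving on non-negative reals.  `sumR lo hi f` is `Σ_{j=lo}^{hi} f j`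
(Mathematica `Sum[…, {j, lo, hi}]`); `oddComp a n` is `1 − (1 − a)^(2n+1)` (the factor `1 − (1 − z³)^(2d−3)` of cell 37,
increasing for EVERY `a ≥ 0` because the exponent is odd); `divN a n` is `a / n`. [folklore] -/
inductive PX (ι κ : Type) : Type where
  | atom (i : ι)
  | tab (k : κ)
  | num (n : ℕ)
  | add (a b : PX ι κ)
  | mul (a b : PX ι κ)
  | divN (a : PX ι κ) (n : ℕ)
  | emax (a b : PX ι κ)
  | emin (a b : PX ι κ)
  | pow (a : PX ι κ) (n : ℕ)
  | oddComp (a : PX ι κ) (n : ℕ)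
  | sumR (lo hi : ℕ) (f : ℕ → PX ι κ)

namespace PX

variable {ι κ : Type}

/-- `+` of positive expressions. [folklore] -/
instance : Add (PX ι κ) := ⟨PX.add⟩
/-- `*` of positive expressions. [folklore] -/
instance : Mul (PX ι κ) := ⟨PX.mul⟩
/-- natural powers of positive expressions. [folklore] -/
instance : HPow (PX ι κ) ℕ (PX ι κ) := ⟨PX.pow⟩
/-- division of a positive expression by a natural. [folklore] -/
instance : HDiv (PX ι κ) ℕ (PX ι κ) := ⟨PX.divN⟩
/-- `Max` of positive expressions. [folklore] -/
instance : Max (PX ι κ) := ⟨PX.emax⟩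
/-- `Min` of positive expressions. [folklore] -/
instance : Min (PX ι κ) := ⟨PX.emin⟩
/-- natural literals as positive expressions. [folklore] -/
instance (n : ℕ) : OfNat (PX ι κ) n := ⟨PX.num n⟩

/-- `e /ₙ n` = `PX.divN e n`, division by the natural `n`. [folklore] -/
infixl:70 " /ₙ " => PX.divN

/-- natural literal as a positive expression. [folklore] -/
abbrev C (n : ℕ) : PX ι κ := PX.num n

/-- `Σ_{a ∈ l} f a` over an explicit list (Mathematica `Sum[…, {v, list}]`), as iterated `+`. [folklore] -/
def sumL {α : Type} (l : List α) (f : α → PX ι κ) : PX ι κ :=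
  l.foldr (fun a acc => PX.add (f a) acc) (PX.num 0)

/-- REAL SEMANTICS of a positive expression under an atom valuation `va` and a table valuation `vt`. [folklore] -/
noncomputable def eval (va : ι → ℝ) (vt : κ → ℝ) : PX ι κ → ℝ
  | atom i => va i
  | tab k => vt k
  | num n => n
  | add a b => eval va vt a + eval va vt b
  | mul a b => eval va vt a * eval va vt b
  | divN a n => eval va vt a / n
  | emax a b => max (eval va vt a) (eval va vt b)
  | emin a b => min (eval va vt a) (eval va vt b)
  | pow a n => (eval va vt a) ^ n
  | oddComp a n => 1 - (1 - eval va vt a) ^ (2 * n + 1)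
  | sumR lo hi f => ∑ j ∈ Finset.Icc lo hi, eval va vt (f j)

/-- `Float` power by a natural (validation aid). [folklore] -/
def fpow (x : Float) : ℕ → Float
  | 0 => 1
  | n + 1 => fpow x n * x

/-- FLOAT SEMANTICS, the same recursion as `eval` over `Float` — a validation aid for re-evaluating the typed cells
numerically; no theorem depends on it. [folklore] -/
def evalF (va : ι → Float) (vt : κ → Float) : PX ι κ → Float
  | atom i => va i
  | tab k => vt k
  | num n => Float.ofNat n
  | add a b => evalF va vt a + evalF va vt b
  | mul a b => evalF va vt a * evalF va vt b
  | divN a n => evalF va vt a / Float.ofNat n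
  | emax a b => max (evalF va vt a) (evalF va vt b)
  | emin a b => min (evalF va vt a) (evalF va vt b)
  | pow a n => fpow (evalF va vt a) n
  | oddComp a n => 1 - fpow (1 - evalF va vt a) (2 * n + 1)
  | sumR lo hi f => (List.range' lo (hi + 1 - lo)).foldl (fun acc j => acc + evalF va vt (f j)) 0

section Order

variable {va va' : ι → ℝ} {vt : κ → ℝ}

/-- `eval` commutes with the constructor (`add`). [folklore] -/
@[simp] theorem eval_add (a b : PX ι κ) : eval va vt (a + b) = eval va vt a + eval va vt b := rfl
/-- `eval` commutes with the constructor (`mul`). [folklore] -/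
@[simp] theorem eval_mul (a b : PX ι κ) : eval va vt (a * b) = eval va vt a * eval va vt b := rfl
/-- `eval` commutes with the constructor (`hpow`). [folklore] -/
@[simp] theorem eval_hpow (a : PX ι κ) (n : ℕ) : eval va vt (a ^ n) = eval va vt a ^ n := rfl
/-- `eval` commutes with the constructor (`hdiv`). [folklore] -/
@[simp] theorem eval_hdiv (a : PX ι κ) (n : ℕ) : eval va vt (a / n) = eval va vt a / n := rfl
/-- `eval` commutes with the constructor (`max`). [folklore] -/
@[simp] theorem eval_max (a b : PX ι κ) : eval va vt (max a b) = max (eval va vt a) (eval va vt b) := rfl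
/-- `eval` commutes with the constructor (`min`). [folklore] -/
@[simp] theorem eval_min (a b : PX ι κ) : eval va vt (min a b) = min (eval va vt a) (eval va vt b) := rfl
/-- `eval` commutes with the constructor (`C`). [folklore] -/
@[simp] theorem eval_C (n : ℕ) : eval va vt (C n : PX ι κ) = n := rfl
/-- `eval` commutes with the constructor (`atom`). [folklore] -/
@[simp] theorem eval_atom (i : ι) : eval va vt (atom i : PX ι κ) = va i := rfl
/-- `eval` commutes with the constructor (`tab`). [folklore] -/
@[simp] theorem eval_tab (k : κ) : eval va vt (tab k : PX ι κ) = vt k := rfl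
/-- `eval` commutes with the constructor (`num`). [folklore] -/
@[simp] theorem eval_num (n : ℕ) : eval va vt (num n : PX ι κ) = n := rfl
/-- `eval` commutes with the constructor (`ofNat`). [folklore] -/
@[simp] theorem eval_ofNat (n : ℕ) : eval va vt (OfNat.ofNat n : PX ι κ) = n := rfl
/-- `eval` commutes with the constructor (`divN`). [folklore] -/
@[simp] theorem eval_divN (a : PX ι κ) (n : ℕ) : eval va vt (a /ₙ n) = eval va vt a / n := rfl
/-- `eval` commutes with the constructor (`oddComp`). [folklore] -/
@[simp] theorem eval_oddComp (a : PX ι κ) (n : ℕ) :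
    eval va vt (oddComp a n) = 1 - (1 - eval va vt a) ^ (2 * n + 1) := rfl
/-- `eval` commutes with the constructor (`sumR`). [folklore] -/
@[simp] theorem eval_sumR (lo hi : ℕ) (f : ℕ → PX ι κ) :
    eval va vt (sumR lo hi f) = ∑ j ∈ Finset.Icc lo hi, eval va vt (f j) := rfl

/-- `eval` of a list sum is the list sum of the values. [folklore] -/
theorem eval_sumL {α : Type} (l : List α) (f : α → PX ι κ) :
    eval va vt (sumL l f) = (l.map fun a => eval va vt (f a)).sum := by
  induction l with
  | nil => simp [sumL]
  | cons a l ih =>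
      simp only [sumL, List.foldr_cons, List.map_cons, List.sum_cons] at ih ⊢
      rw [eval, ih]

/-- An odd power is monotone on all of `ℝ`. [folklore] -/
theorem odd_pow_mono (n : ℕ) {x y : ℝ} (h : x ≤ y) : x ^ (2 * n + 1) ≤ y ^ (2 * n + 1) :=
  (Odd.strictMono_pow (R := ℝ) ⟨n, rfl⟩).monotone h

/-- EVERY positive expression is `≥ 0` when atoms and tables are. [folklore] -/
theorem eval_nonneg (ha : ∀ i, 0 ≤ va i) (ht : ∀ k, 0 ≤ vt k) : ∀ e : PX ι κ, 0 ≤ eval va vt e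
  | atom i => ha i
  | tab k => ht k
  | num n => by simp [eval]
  | add a b => add_nonneg (eval_nonneg ha ht a) (eval_nonneg ha ht b)
  | mul a b => mul_nonneg (eval_nonneg ha ht a) (eval_nonneg ha ht b)
  | divN a n => div_nonneg (eval_nonneg ha ht a) (Nat.cast_nonneg n)
  | emax a b => le_max_of_le_left (eval_nonneg ha ht a)
  | emin a b => le_min (eval_nonneg ha ht a) (eval_nonneg ha ht b)
  | pow a n => pow_nonneg (eval_nonneg ha ht a) n
  | oddComp a n => by
      have h0 := eval_nonneg ha ht a
      have h1 : (1 - eval va vt a) ^ (2 * n + 1) ≤ 1 ^ (2 * n + 1) := odd_pow_mono n (by linarith)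
      simp only [one_pow] at h1
      show 0 ≤ 1 - (1 - eval va vt a) ^ (2 * n + 1)
      linarith
  | sumR lo hi f => Finset.sum_nonneg fun j _ => eval_nonneg ha ht (f j)

/-- EVERY positive expression is ORDER-PRESERVING in the atom valuation (tables fixed): `va ≤ va'` pointwise, atoms and
tables `≥ 0` ⟹ `eval va ≤ eval va'`.  This is the whole content of the stage-1 cell-sign census HOME/MARGINS.md M1/M2
for the cells typed as `PX` terms. [folklore] -/
theorem eval_mono (ha : ∀ i, 0 ≤ va i) (hle : ∀ i, va i ≤ va' i) (ht : ∀ k, 0 ≤ vt k) :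
    ∀ e : PX ι κ, eval va vt e ≤ eval va' vt e
  | atom i => hle i
  | tab k => le_rfl
  | num n => le_rfl
  | add a b => add_le_add (eval_mono ha hle ht a) (eval_mono ha hle ht b)
  | mul a b => by
      have ha' : ∀ i, 0 ≤ va' i := fun i => (ha i).trans (hle i)
      exact mul_le_mul (eval_mono ha hle ht a) (eval_mono ha hle ht b) (eval_nonneg ha ht b)
        (eval_nonneg ha' ht a)
  | divN a n => div_le_div_of_nonneg_right (eval_mono ha hle ht a) (Nat.cast_nonneg n)
  | emax a b => max_le_max (eval_mono ha hle ht a) (eval_mono ha hle ht b)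
  | emin a b => min_le_min (eval_mono ha hle ht a) (eval_mono ha hle ht b)
  | pow a n => pow_le_pow_left₀ (eval_nonneg ha ht a) (eval_mono ha hle ht a) n
  | oddComp a n => by
      have h := odd_pow_mono n (sub_le_sub_left (eval_mono ha hle ht a) 1)
      show 1 - (1 - eval va vt a) ^ (2 * n + 1) ≤ 1 - (1 - eval va' vt a) ^ (2 * n + 1)
      linarith
  | sumR lo hi f => Finset.sum_le_sum fun j _ => eval_mono ha hle ht (f j)

end Order

/-! ### Relative order preservation: comparing valuations that increase only on the atoms a term mentions -/

/-- `OnlyAtoms q e`: every atom occurring in `e` satisfies `q` (for a range sum: at every index). [folklore] -/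
def OnlyAtoms (q : ι → Prop) : PX ι κ → Prop
  | atom i => q i
  | tab _ => True
  | num _ => True
  | add a b => OnlyAtoms q a ∧ OnlyAtoms q b
  | mul a b => OnlyAtoms q a ∧ OnlyAtoms q b
  | divN a _ => OnlyAtoms q a
  | emax a b => OnlyAtoms q a ∧ OnlyAtoms q b
  | emin a b => OnlyAtoms q a ∧ OnlyAtoms q b
  | pow a _ => OnlyAtoms q a
  | oddComp a _ => OnlyAtoms q a
  | sumR _ _ f => ∀ j, OnlyAtoms q (f j)

section OnlyAtoms

variable {q : ι → Prop}

/-- `OnlyAtoms` through the constructor (`atom`). [folklore] -/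
@[simp] theorem onlyAtoms_atom (i : ι) : OnlyAtoms q (atom i : PX ι κ) ↔ q i := Iff.rfl
/-- `OnlyAtoms` through the constructor (`tab`). [folklore] -/
@[simp] theorem onlyAtoms_tab (k : κ) : OnlyAtoms q (tab k : PX ι κ) := trivial
/-- `OnlyAtoms` through the constructor (`num`). [folklore] -/
@[simp] theorem onlyAtoms_num (n : ℕ) : OnlyAtoms q (num n : PX ι κ) := trivial
/-- `OnlyAtoms` through the constructor (`C`). [folklore] -/
@[simp] theorem onlyAtoms_C (n : ℕ) : OnlyAtoms q (C n : PX ι κ) := trivial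
/-- `OnlyAtoms` through the constructor (`ofNat`). [folklore] -/
@[simp] theorem onlyAtoms_ofNat (n : ℕ) : OnlyAtoms q (OfNat.ofNat n : PX ι κ) := trivial
/-- `OnlyAtoms` through the constructor (`add`). [folklore] -/
@[simp] theorem onlyAtoms_add (a b : PX ι κ) : OnlyAtoms q (a + b) ↔ OnlyAtoms q a ∧ OnlyAtoms q b := Iff.rfl
/-- `OnlyAtoms` through the constructor (`mul`). [folklore] -/
@[simp] theorem onlyAtoms_mul (a b : PX ι κ) : OnlyAtoms q (a * b) ↔ OnlyAtoms q a ∧ OnlyAtoms q b := Iff.rfl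
/-- `OnlyAtoms` through the constructor (`hdiv`). [folklore] -/
@[simp] theorem onlyAtoms_hdiv (a : PX ι κ) (n : ℕ) : OnlyAtoms q (a / n) ↔ OnlyAtoms q a := Iff.rfl
/-- `OnlyAtoms` through the constructor (`divN`). [folklore] -/
@[simp] theorem onlyAtoms_divN (a : PX ι κ) (n : ℕ) : OnlyAtoms q (a /ₙ n) ↔ OnlyAtoms q a := Iff.rfl
/-- `OnlyAtoms` through the constructor (`max`). [folklore] -/
@[simp] theorem onlyAtoms_max (a b : PX ι κ) : OnlyAtoms q (max a b) ↔ OnlyAtoms q a ∧ OnlyAtoms q b := Iff.rfl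
/-- `OnlyAtoms` through the constructor (`min`). [folklore] -/
@[simp] theorem onlyAtoms_min (a b : PX ι κ) : OnlyAtoms q (min a b) ↔ OnlyAtoms q a ∧ OnlyAtoms q b := Iff.rfl
/-- `OnlyAtoms` through the constructor (`hpow`). [folklore] -/
@[simp] theorem onlyAtoms_hpow (a : PX ι κ) (n : ℕ) : OnlyAtoms q (a ^ n) ↔ OnlyAtoms q a := Iff.rfl
/-- `OnlyAtoms` through the constructor (`oddComp`). [folklore] -/
@[simp] theorem onlyAtoms_oddComp (a : PX ι κ) (n : ℕ) : OnlyAtoms q (oddComp a n) ↔ OnlyAtoms q a := Iff.rfl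
/-- `OnlyAtoms` through the constructor (`sumR`). [folklore] -/
@[simp] theorem onlyAtoms_sumR (lo hi : ℕ) (f : ℕ → PX ι κ) :
    OnlyAtoms q (sumR lo hi f) ↔ ∀ j, OnlyAtoms q (f j) := Iff.rfl

variable {va va' : ι → ℝ} {vt : κ → ℝ}

/-- RELATIVE order preservation: if `va ≤ va'` on the atoms satisfying `q` (both valuations and the tables `≥ 0`),
every term mentioning only such atoms increases from `va` to `va'` — used to compare one cell at the two evaluation
points `i`, `o`, whose valuations are comparable on `z`, `VarGamma2` but not on the `f₃`-weights. [folklore] -/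
theorem eval_mono_on (ha : ∀ i, 0 ≤ va i) (ha' : ∀ i, 0 ≤ va' i) (hle : ∀ i, q i → va i ≤ va' i)
    (ht : ∀ k, 0 ≤ vt k) : ∀ e : PX ι κ, OnlyAtoms q e → eval va vt e ≤ eval va' vt e
  | atom i, h => hle i h
  | tab _, _ => le_rfl
  | num _, _ => le_rfl
  | add a b, h => add_le_add (eval_mono_on ha ha' hle ht a h.1) (eval_mono_on ha ha' hle ht b h.2)
  | mul a b, h => mul_le_mul (eval_mono_on ha ha' hle ht a h.1) (eval_mono_on ha ha' hle ht b h.2)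
      (eval_nonneg ha ht b) (eval_nonneg ha' ht a)
  | divN a n, h => div_le_div_of_nonneg_right (eval_mono_on ha ha' hle ht a h) (Nat.cast_nonneg n)
  | emax a b, h => max_le_max (eval_mono_on ha ha' hle ht a h.1) (eval_mono_on ha ha' hle ht b h.2)
  | emin a b, h => min_le_min (eval_mono_on ha ha' hle ht a h.1) (eval_mono_on ha ha' hle ht b h.2)
  | pow a n, h => pow_le_pow_left₀ (eval_nonneg ha ht a) (eval_mono_on ha ha' hle ht a h) n
  | oddComp a n, h => by
      have h' := odd_pow_mono n (sub_le_sub_left (eval_mono_on ha ha' hle ht a h) 1)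
      show 1 - (1 - eval va vt a) ^ (2 * n + 1) ≤ 1 - (1 - eval va' vt a) ^ (2 * n + 1)
      linarith
  | sumR lo hi f, h => Finset.sum_le_sum fun j _ => eval_mono_on ha ha' hle ht (f j) (h j)

/-- Two valuations that agree on the atoms occurring in a term give it the same value. [folklore] -/
theorem eval_congr_on (heq : ∀ i, q i → va i = va' i) : ∀ e : PX ι κ, OnlyAtoms q e → eval va vt e = eval va' vt e
  | atom i, h => heq i h
  | tab _, _ => rfl
  | num _, _ => rfl
  | add a b, h => by simp only [eval, eval_congr_on heq a h.1, eval_congr_on heq b h.2]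
  | mul a b, h => by simp only [eval, eval_congr_on heq a h.1, eval_congr_on heq b h.2]
  | divN a n, h => by simp only [eval, eval_congr_on heq a h]
  | emax a b, h => by simp only [eval, eval_congr_on heq a h.1, eval_congr_on heq b h.2]
  | emin a b, h => by simp only [eval, eval_congr_on heq a h.1, eval_congr_on heq b h.2]
  | pow a n, h => by simp only [eval, eval_congr_on heq a h]
  | oddComp a n, h => by simp only [eval, eval_congr_on heq a h]
  | sumR lo hi f, h => Finset.sum_congr rfl fun j _ => eval_congr_on heq (f j) (h j)

end OnlyAtoms

end PX

end Literature.Probability.FitznerVanDerHofstad2017
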